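import Literature.Combinatorics.LorentzianPolynomials.StrictlyLorentzianOneAddXPderiv
import HarnessLib

/-!
# Brändén–Huh's Nuij-type homotopy: Lemma 2.12 (`T_n(θ, f) ∈ L̊^d_n` for `f ∈ L^d_n ∩ P^d_n`, `θ > 0`)

Layer `Literature/Combinatorics/LorentzianPolynomials`, namespace `Literature.Combinatorics.LorentzianPolynomials`;
lane `lit-hodgefound` (Track 2 foundations library), seat p16, generation 29 (row g29-#9). Continues
`StrictlyLorentzianOneAddXPderiv` (claim (I) of the proof of Lemma 2.12) with claims (III) and (II) and the lemma itself,
everything — as in the source — on a fixed line `x e_j - v` and for a fixed `α ∈ Δ^{d-2}_n`, in the Hessian language of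
Lemma 2.5 (`StrictlyLorentzianQuadratic`): "two distinct real zeros" = the strict reverse Cauchy–Schwarz inequality
`B(v,v)B(e_j,e_j) < B(v,e_j)²`, "a multiple zero `c`" = equality together with the critical point `c = B(e_j,v)/B(e_j,e_j)`.

## Source (verbatim) — P. Brändén, J. Huh, *Lorentzian polynomials* [BrandenHuh2019] (held `paper:arxiv-1902.03719`)

§2.3 (pp. 15–16): "Let `θ` be a nonnegative real parameter. We define a linear operator `T_n(θ, -)` by
`T_n(θ, f) = (∏_{i=1}^{n-1} (1 + θ w_i ∂_n)^d) f`. By Proposition 2.7, if `f ∈ L^d_n`, then `T_n(θ, f) ∈ L^d_n`. In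
addition, if `f ∈ P^d_n`, then `T_n(θ, f) ∈ P^d_n`. Most importantly, the operator `T_n` satisfies the following
Nuij-type homotopy lemma. […] **Lemma 2.12.** If `f ∈ L^d_n ∩ P^d_n`, then `T_n(θ, f) ∈ L̊^d_n` for every positive
real number `θ`. *Proof.* Let `e_i` be the `i`-th standard unit vector in `ℝ^n`, and let `v` be any vector in `ℝ^n`
not parallel to `e_n`. From here on, in this proof, all polynomials are restricted to the line `x e_n - v` and
considered as univariate polynomials in `x`. Let `α` be an arbitrary element of `Δ^{d-2}_n`. By Lemma 2.5, it is enough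
to show that the quadratic polynomial `∂^α T_n(θ, f)` has two distinct real zeros. Using Proposition 2.7, we can deduce
the preceding statement from the following claims: (I) If `∂^α f` has two distinct real zeros, then
`∂^α (1 + θ w_i ∂_n) f` has two distinct zeros. (II) If `v_i` is nonzero, then `∂^α (1 + θ w_i ∂_n)^d f` has two
distinct real zeros. […] Before proving (II), we strengthen (I) as follows: (III) A multiple zero of `∂^α g` is
necessarily a multiple zero of `∂^α f`. Suppose `∂^α g` has a multiple zero. Using (I), we know that `∂^α f` has a
multiple zero, say `c`. Clearly, `c` must be also a zero of `∂^{α+e_n} f`. Since `c` interlaces the two (not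
necessarily distinct) zeros of `∂^{α-e_i+e_n} f`, we have `∂^α g|_{x=c} = θ α_i ∂^{α-e_i+e_n} f|_{x=c} ≤ 0`. Therefore,
if `c` is not a zero of `∂^α g`, then `∂^α g` has two distinct zeros, contradicting the hypothesis that `∂^α g` has a
multiple zero. This completes the proof of (III). We prove (II). Suppose `∂^α (1 + θ w_i ∂_n)^d f` has a multiple
zero, say `c`. Using (III), we know that the number `c` is a multiple zero of `∂^α (1 + θ w_i ∂_n)^k f` for all
`0 ≤ k ≤ d`. Expanding the `k`-th power and using the linearity of `∂^α`, we deduce that the number `c` is a zero of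
`∂^α w_i^k ∂_n^k f` for all `0 ≤ k ≤ d`. However, since `f` has positive coefficients, the value of
`∂^α w_i^{α_i+2} ∂_n^{α_i+2} f` at `c` is a positive multiple of `v_i²`, and hence `v_i` must be zero. This completes
the proof of (II)."

## What is here

* §1 the powers `(1 + θ w_i ∂_j)^k` for `i ≠ j`: "Expanding the `k`-th power" — `(1 + θ w_i ∂_j)^k f =
  Σ_l C(k,l) θ^l w_i^l ∂_j^l f` (`iterate_oneAddXPderiv_eq_sum`), membership of the iterates in `L^d_n ∩ P^d_n`, and
  the triangular elimination `Σ_{l ≤ k} C(k,l) θ^l a_l = 0 (k ≤ d) ⟹ a_l = 0 (l ≤ d)`.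
* §2 "the value of `∂^α w_i^{α_i+2} ∂_n^{α_i+2} f` at `c` is a positive multiple of `v_i²`": the quadratic
  `∂^α (w_i^{α_i+2} h)` is `(K/2) w_i²`, `K = (α+2e_i)! coeff_{α-α_i e_i}(h) > 0`.
* §3 **claim (III)** (`mul_eq_sq_and_crit_eq_of_oneAddXPderiv`): a double zero of `∂^α (1 + θ w_i ∂_j) f` on the line
  is a double zero of `∂^α f`, at the same point.
* §4 **claim (II)** (`mul_lt_sq_hessian_iterPderiv_iterate_oneAddXPderiv`): if `v_i ≠ 0` (`i ≠ j`) then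
  `∂^α (1 + θ w_i ∂_j)^d f` has two distinct real zeros on `x e_j - v`, for `f ∈ L^d_n ∩ P^d_n`, `θ > 0`.
* §5 **Lemma 2.12** (`nuijOperator_mem_strictlyLorentzian`) for the operator
  `nuijOperator θ j d = ∏_{i ≠ j} (1 + θ w_i ∂_j)^d` (`T_n(θ, -)` with `n ↦ j`; the order of the commuting blocks is the
  one of `Finset.toList`).

One definition with body (`nuijOperator`), theorems otherwise; no `sorry`, no named fact (net debt 0).

## References

* [BrandenHuh2019] P. Brändén, J. Huh, *Lorentzian polynomials*, Ann. of Math. (2) 192 (2020) 821–891, arXiv:1902.03719 —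
  §2.3 Lemma 2.12 and its proof (pp. 15–16); §2.1 Lemma 2.5; §2.2 Prop. 2.7.
* [Nuij1968] W. Nuij, *A note on hyperbolic polynomials*, Math. Scand. 23 (1968) 69–72 (the homotopy the lemma is
  modelled on; cited by the source as [Nui68]).
-/

noncomputable section

open MvPolynomial Finsupp Finset
open Literature.LinearAlgebra.QuadraticForm

namespace Literature.Combinatorics.LorentzianPolynomials

variable {σ : Type*} [Fintype σ] [DecidableEq σ]

/-! ## §1 The powers `(1 + θ w_i ∂_j)^k` -/

section Powers

omit [Fintype σ] [DecidableEq σ] in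
/-- `∂_j (w_i^l h) = w_i^l ∂_j h` for `i ≠ j`. [cite: BrandenHuh2019, §2.3 proof of Lemma 2.12 ((II): "`∂^α w_i^k ∂_n^k
f`")] -/
theorem pderiv_X_pow_mul_of_ne {i j : σ} (hij : i ≠ j) (l : ℕ) (h : MvPolynomial σ ℝ) :
    pderiv j (X i ^ l * h) = X i ^ l * pderiv j h := by
  rw [pderiv_mul, pderiv_pow, pderiv_X_of_ne hij, mul_zero, zero_mul, zero_add]

omit [Fintype σ] [DecidableEq σ] in
/-- **The operator `w_i ∂_j`** as a linear endomorphism of `ℝ[w]`. [cite: BrandenHuh2019, §2.2 Prop. 2.7 / §2.3 (the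
operators `1 + θ w_i ∂_n`)] -/
def xPderiv (i j : σ) : MvPolynomial σ ℝ →ₗ[ℝ] MvPolynomial σ ℝ where
  toFun f := X i * pderiv j f
  map_add' f g := by rw [map_add, mul_add]
  map_smul' c f := by rw [Derivation.map_smul, mul_smul_comm, RingHom.id_apply]

omit [Fintype σ] [DecidableEq σ] in
/-- `xPderiv i j f = w_i ∂_j f`. [cite: BrandenHuh2019, §2.3 (the operators `1 + θ w_i ∂_n`)] -/
@[simp] theorem xPderiv_apply (i j : σ) (f : MvPolynomial σ ℝ) : xPderiv i j f = X i * pderiv j f := rfl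

omit [Fintype σ] [DecidableEq σ] in
/-- `(1 + θ w_i ∂_j) f` is the endomorphism `1 + θ · xPderiv i j` applied to `f`. [cite: BrandenHuh2019, §2.3 (the
operators `1 + θ w_i ∂_n`)] -/
theorem oneAddXPderiv_eq_end_apply (θ : ℝ) (i j : σ) (f : MvPolynomial σ ℝ) :
    oneAddXPderiv θ i j f = ((1 : Module.End ℝ (MvPolynomial σ ℝ)) + θ • xPderiv i j) f := by
  rw [LinearMap.add_apply, Module.End.one_apply, LinearMap.smul_apply, xPderiv_apply, oneAddXPderiv_def]

omit [Fintype σ] [DecidableEq σ] in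
/-- `(1 + θ w_i ∂_j)^k f` as the `k`-th power of the endomorphism. [cite: BrandenHuh2019, §2.3 (the powers
`(1 + θ w_i ∂_n)^d`)] -/
theorem iterate_oneAddXPderiv_eq_pow_apply (θ : ℝ) (i j : σ) (k : ℕ) (f : MvPolynomial σ ℝ) :
    (oneAddXPderiv θ i j)^[k] f = (((1 : Module.End ℝ (MvPolynomial σ ℝ)) + θ • xPderiv i j) ^ k) f := by
  induction k with
  | zero => rw [Function.iterate_zero, id_eq, pow_zero, Module.End.one_apply]
  | succ k ih => rw [Function.iterate_succ_apply', ih, pow_succ', Module.End.mul_apply, oneAddXPderiv_eq_end_apply]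

omit [Fintype σ] [DecidableEq σ] in
/-- `(w_i ∂_j)^l f = w_i^l ∂_j^l f` for `i ≠ j`. [cite: BrandenHuh2019, §2.3 proof of Lemma 2.12 ((II): "`∂^α w_i^k
∂_n^k f`")] -/
theorem xPderiv_pow_apply {i j : σ} (hij : i ≠ j) (l : ℕ) (f : MvPolynomial σ ℝ) :
    (xPderiv i j ^ l) f = X i ^ l * (pderiv j)^[l] f := by
  induction l with
  | zero => rw [pow_zero, Module.End.one_apply, pow_zero, one_mul, Function.iterate_zero, id_eq]
  | succ l ih =>
    rw [pow_succ', Module.End.mul_apply, ih, xPderiv_apply, pderiv_X_pow_mul_of_ne hij, ← mul_assoc, ← pow_succ',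
      Function.iterate_succ_apply']

omit [Fintype σ] [DecidableEq σ] in
/-- **"Expanding the `k`-th power": `(1 + θ w_i ∂_j)^k f = Σ_{l=0}^{k} C(k,l) θ^l · w_i^l ∂_j^l f` for `i ≠ j`.**
[cite: BrandenHuh2019, §2.3 proof of Lemma 2.12 ((II): "Expanding the `k`-th power and using the linearity of
`∂^α`")] -/
theorem iterate_oneAddXPderiv_eq_sum {i j : σ} (hij : i ≠ j) (θ : ℝ) (k : ℕ) (f : MvPolynomial σ ℝ) :
    (oneAddXPderiv θ i j)^[k] f =
      ∑ l ∈ Finset.range (k + 1), (θ ^ l * (k.choose l : ℝ)) • (X i ^ l * (pderiv j)^[l] f) := by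
  rw [iterate_oneAddXPderiv_eq_pow_apply, add_comm, (Commute.one_right (θ • xPderiv i j)).add_pow,
    LinearMap.sum_apply]
  refine Finset.sum_congr rfl fun l _ ↦ ?_
  rw [one_pow, mul_one, Module.End.mul_apply, Module.End.natCast_apply, smul_pow, LinearMap.smul_apply, map_nsmul,
    xPderiv_pow_apply hij, ← Nat.cast_smul_eq_nsmul ℝ, smul_smul]

/-- The iterates `(1 + θ w_i ∂_j)^k f` stay in `L^d_n` (Proposition 2.7). [cite: BrandenHuh2019, §2.3 (p. 15, "By
Proposition 2.7, if `f ∈ L^d_n`, then `T_n(θ, f) ∈ L^d_n`")] -/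
theorem iterate_oneAddXPderiv_mem_lorentzian {d : ℕ} {f : MvPolynomial σ ℝ} (hf : f ∈ lorentzian σ d) {θ : ℝ}
    (hθ : 0 ≤ θ) (i j : σ) : ∀ k : ℕ, (oneAddXPderiv θ i j)^[k] f ∈ lorentzian σ d
  | 0 => by simpa using hf
  | k + 1 => by
    rw [Function.iterate_succ_apply']
    exact oneAddXPderiv_mem_lorentzian (iterate_oneAddXPderiv_mem_lorentzian hf hθ i j k) hθ i j

omit [Fintype σ] [DecidableEq σ] in
/-- The iterates `(1 + θ w_i ∂_j)^k f` stay homogeneous of degree `d`. [cite: BrandenHuh2019, §2.3 (p. 15, the operator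
`T_n` on `H^d_n`)] -/
theorem isHomogeneous_iterate_oneAddXPderiv {d : ℕ} {f : MvPolynomial σ ℝ} (hf : f.IsHomogeneous d) (θ : ℝ)
    (i j : σ) : ∀ k : ℕ, ((oneAddXPderiv θ i j)^[k] f).IsHomogeneous d
  | 0 => by simpa using hf
  | k + 1 => by
    rw [Function.iterate_succ_apply']
    exact isHomogeneous_oneAddXPderiv θ i j (isHomogeneous_iterate_oneAddXPderiv hf θ i j k)

omit [DecidableEq σ] in
/-- The iterates `(1 + θ w_i ∂_j)^k f` stay in `P^d_n`. [cite: BrandenHuh2019, §2.3 (p. 15, "if `f ∈ P^d_n`, then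
`T_n(θ, f) ∈ P^d_n`")] -/
theorem coeff_iterate_oneAddXPderiv_pos {d : ℕ} {f : MvPolynomial σ ℝ} (hf : f.IsHomogeneous d)
    (hpos : ∀ β : σ →₀ ℕ, β.degree = d → 0 < coeff β f) {θ : ℝ} (hθ : 0 ≤ θ) (i j : σ) :
    ∀ (k : ℕ) (β : σ →₀ ℕ), β.degree = d → 0 < coeff β ((oneAddXPderiv θ i j)^[k] f)
  | 0 => by simpa using hpos
  | k + 1 => by
    rw [Function.iterate_succ_apply']
    exact coeff_oneAddXPderiv_pos hθ i j (isHomogeneous_iterate_oneAddXPderiv hf θ i j k)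
      (coeff_iterate_oneAddXPderiv_pos hf hpos hθ i j k)

omit [Fintype σ] [DecidableEq σ] in
/-- **Triangular elimination**: if `Σ_{l ≤ k} θ^l C(k,l) a_l = 0` for every `k ≤ d` and `θ ≠ 0`, then `a_l = 0` for
every `l ≤ d` ("the number `c` is a zero of `∂^α w_i^k ∂_n^k f` for all `0 ≤ k ≤ d`"). [cite: BrandenHuh2019, §2.3
proof of Lemma 2.12 ((II))] -/
theorem eq_zero_of_forall_sum_choose_mul_eq_zero {θ : ℝ} (hθ : θ ≠ 0) {a : ℕ → ℝ} {d : ℕ}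
    (h : ∀ k ≤ d, ∑ l ∈ Finset.range (k + 1), θ ^ l * (k.choose l : ℝ) * a l = 0) : ∀ l ≤ d, a l = 0 := by
  intro l
  induction l using Nat.strong_induction_on with
  | _ l ih =>
    intro hl
    have hk := h l hl
    have hrest : ∑ l' ∈ Finset.range l, θ ^ l' * (l.choose l' : ℝ) * a l' = 0 :=
      Finset.sum_eq_zero fun l' hl' ↦ by
        rw [ih l' (Finset.mem_range.1 hl') (by have := Finset.mem_range.1 hl'; omega), mul_zero]
    rw [Finset.sum_range_succ, hrest, zero_add, Nat.choose_self, Nat.cast_one, mul_one] at hk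
    exact (mul_eq_zero.1 hk).resolve_left (pow_ne_zero _ hθ)

end Powers

/-! ## §2 The quadratic `∂^α (w_i^{α_i+2} h)` is a positive multiple of `w_i²` -/

section PureSquare

omit [DecidableEq σ] in
/-- `∂_j^s f = ∂^{s e_j} f`. [cite: BrandenHuh2019, §2.1 (p. 8, `∂^α`)] -/
theorem iterate_pderiv_eq_iterPderiv (j : σ) :
    ∀ (s : ℕ) (f : MvPolynomial σ ℝ), (pderiv j)^[s] f = iterPderiv (Finsupp.single j s) f
  | 0, f => by rw [Function.iterate_zero, id_eq, Finsupp.single_zero, iterPderiv_zero]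
  | s + 1, f => by
    rw [Function.iterate_succ_apply', iterate_pderiv_eq_iterPderiv j s f, ← iterPderiv_add_single,
      ← Finsupp.single_add]

omit [Fintype σ] [DecidableEq σ] in
/-- `α + 2e_i - (α_i + 2) e_i = α - α_i e_i` (the exponent `α` with its `i`-th entry erased).
[cite: BrandenHuh2019, §2.3 proof of Lemma 2.12 ((II): "`∂^α w_i^{α_i+2} ∂_n^{α_i+2} f`")] -/
theorem add_single_add_single_sub_single (α : σ →₀ ℕ) (i : σ) :
    α + Finsupp.single i 1 + Finsupp.single i 1 - Finsupp.single i (α i + 2) = α.erase i := by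
  classical
  ext k
  by_cases hk : k = i
  · rw [hk, Finsupp.tsub_apply, Finsupp.add_apply, Finsupp.add_apply, Finsupp.single_eq_same, Finsupp.single_eq_same,
      Finsupp.erase_same]
    omega
  · rw [Finsupp.tsub_apply, Finsupp.add_apply, Finsupp.add_apply, Finsupp.single_eq_of_ne hk,
      Finsupp.single_eq_of_ne hk, Finsupp.erase_ne hk]
    omega

/-- The off-`(i,i)` Hessian entries of `∂^α (w_i^{α_i+2} h)` vanish: a monomial of `w_i^{α_i+2} h` has `w_i`-degree at
least `α_i + 2`, so after `∂^α` at least `2`. [cite: BrandenHuh2019, §2.3 proof of Lemma 2.12 ((II))] -/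
theorem hessian_iterPderiv_X_pow_mul_of_ne (α : σ →₀ ℕ) (i : σ) (h : MvPolynomial σ ℝ) {p r : σ} (hpr : ¬(p = i ∧ r = i)) :
    hessian (iterPderiv α (X i ^ (α i + 2) * h)) p r = 0 := by
  rw [hessian_iterPderiv, normCoeff_def, X_pow_eq_monomial, coeff_monomial_mul', if_neg, mul_zero]
  rw [Finsupp.single_le_iff, Finsupp.add_apply, Finsupp.add_apply, Finsupp.single_apply, Finsupp.single_apply]
  by_cases hp : p = i
  · have hr : ¬r = i := fun hr ↦ hpr ⟨hp, hr⟩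
    rw [if_pos hp, if_neg hr]; omega
  · rw [if_neg hp]
    split_ifs <;> omega

omit [DecidableEq σ] in
/-- The `(i,i)` Hessian entry of `∂^α (w_i^{α_i+2} h)` is `(α + 2e_i)! · coeff_{α - α_i e_i}(h)`.
[cite: BrandenHuh2019, §2.3 proof of Lemma 2.12 ((II): "a positive multiple of `v_i²`")] -/
theorem hessian_iterPderiv_X_pow_mul_self (α : σ →₀ ℕ) (i : σ) (h : MvPolynomial σ ℝ) :
    hessian (iterPderiv α (X i ^ (α i + 2) * h)) i i =
      factorialProd (α + Finsupp.single i 1 + Finsupp.single i 1) * coeff (α.erase i) h := by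
  have hle : Finsupp.single i (α i + 2) ≤ α + Finsupp.single i 1 + Finsupp.single i 1 := by
    rw [Finsupp.single_le_iff, Finsupp.add_apply, Finsupp.add_apply, Finsupp.single_eq_same]
  rw [hessian_iterPderiv, normCoeff_def, X_pow_eq_monomial, coeff_monomial_mul', if_pos hle, one_mul,
    add_single_add_single_sub_single]

/-- **"the value of `∂^α w_i^{α_i+2} ∂_n^{α_i+2} f` at `c` is a positive multiple of `v_i²`"**: for the quadratic form
`q = ∂^α (w_i^{α_i+2} h)`, `2 q(w) = (α + 2e_i)! coeff_{α - α_i e_i}(h) · w_i²`. [cite: BrandenHuh2019, §2.3 proof of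
Lemma 2.12 ((II))] -/
theorem two_mul_eval_iterPderiv_X_pow_mul (α : σ →₀ ℕ) (i : σ) {h : MvPolynomial σ ℝ}
    (hq : (iterPderiv α (X i ^ (α i + 2) * h)).IsHomogeneous 2) (w : σ → ℝ) :
    2 * eval w (iterPderiv α (X i ^ (α i + 2) * h)) =
      factorialProd (α + Finsupp.single i 1 + Finsupp.single i 1) * coeff (α.erase i) h * w i ^ 2 := by
  rw [two_mul_eval_eq_toBilin'_hessian hq, Matrix.toBilin'_apply,
    Finset.sum_eq_single_of_mem i (Finset.mem_univ i) (fun p _ hp ↦ Finset.sum_eq_zero fun r _ ↦ by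
      rw [hessian_iterPderiv_X_pow_mul_of_ne α i h (fun hpr ↦ hp hpr.1), mul_zero, zero_mul]),
    Finset.sum_eq_single_of_mem i (Finset.mem_univ i) (fun r _ hr ↦ by
      rw [hessian_iterPderiv_X_pow_mul_of_ne α i h (fun hpr ↦ hr hpr.2), mul_zero, zero_mul]),
    hessian_iterPderiv_X_pow_mul_self]
  ring

omit [Fintype σ] [DecidableEq σ] in
/-- `|α - α_i e_i| + α_i = |α|`. [cite: BrandenHuh2019, §2.1 (p. 8, `|α|_1`)] -/
theorem degree_erase_add (α : σ →₀ ℕ) (i : σ) : (α.erase i).degree + α i = α.degree := by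
  conv_rhs => rw [← Finsupp.erase_add_single i α]
  rw [map_add, degree_single]

omit [DecidableEq σ] in
/-- For `f ∈ P^{m+2}_n`, `α ∈ Δ^m_n` and `h = ∂_j^{α_i+2} f`, the coefficient `coeff_{α - α_i e_i}(h)` is positive.
[cite: BrandenHuh2019, §2.3 proof of Lemma 2.12 ((II): "since `f` has positive coefficients")] -/
theorem coeff_erase_iterate_pderiv_pos {m : ℕ} {f : MvPolynomial σ ℝ}
    (hpos : ∀ β : σ →₀ ℕ, β.degree = m + 2 → 0 < coeff β f) {α : σ →₀ ℕ} (hα : α.degree = m) (i j : σ) :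
    0 < coeff (α.erase i) ((pderiv j)^[α i + 2] f) := by
  rw [iterate_pderiv_eq_iterPderiv, ← normCoeff_pos_iff, normCoeff_iterPderiv, normCoeff_pos_iff]
  refine hpos _ ?_
  have h := degree_erase_add α i
  rw [map_add, degree_single]
  omega

end PureSquare

/-! ## §3 Claim (III): double zeros pass from `∂^α (1 + θ w_i ∂_j) f` back to `∂^α f` -/

section ClaimIII

/-- Completing the square along the line: `B(e,e) · B(xe - v, xe - v) = (B(e,e) x - B(e,v))² + (B(e,e)B(v,v) - B(e,v)²)`.
[cite: BrandenHuh2019, §2.1 Lemma 2.5 (the discriminant of `½ f(xu - v)`); §2.3 proof of Lemma 2.12 ((III))] -/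
theorem toBilin'_self_mul_smul_sub_self {H : Matrix σ σ ℝ} (hH : H.IsSymm) (x : ℝ) (e v : σ → ℝ) :
    Matrix.toBilin' H e e * Matrix.toBilin' H (x • e - v) (x • e - v) =
      (Matrix.toBilin' H e e * x - Matrix.toBilin' H e v) ^ 2 +
        (Matrix.toBilin' H e e * Matrix.toBilin' H v v - Matrix.toBilin' H e v ^ 2) := by
  rw [toBilin'_smul_sub_self hH]
  ring

/-- **On the `P`-critical vector the form of `∂^α (1 + θ w_i ∂_j) f` is dominated by that of `∂^α f`**: for
`f ∈ L^{m+2}_n ∩ P^{m+2}_n`, `θ ≥ 0` and `w` with `B_{∂^α f}(e_j, w) = 0`,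
`B_{∂^α g}(w, w) ≤ B_{∂^α f}(w, w)` — the border term `2θ w_i · uᵀw` vanishes and `θ α_i B_{∂^{α-e_i+e_j} f}(w,w) ≤ 0`
("`∂^α g|_{x=c} = … + θ α_i ∂^{α-e_i+e_n} f|_{x=c}`, `≤ 0`"). [cite: BrandenHuh2019, §2.3 proof of Lemma 2.12 ((I) and
(III))] -/
theorem toBilin'_hessian_iterPderiv_oneAddXPderiv_le {m : ℕ} {f : MvPolynomial σ ℝ} (hL : f ∈ lorentzian σ (m + 2))
    (hP : ∀ β : σ →₀ ℕ, β.degree = m + 2 → 0 < coeff β f) {θ : ℝ} (hθ : 0 ≤ θ) (i j : σ) {α : σ →₀ ℕ}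
    (hα : α.degree = m) {w : σ → ℝ} (hw : Matrix.toBilin' (hessian (iterPderiv α f)) (Pi.single j 1) w = 0) :
    Matrix.toBilin' (hessian (iterPderiv α (oneAddXPderiv θ i j f))) w w ≤
      Matrix.toBilin' (hessian (iterPderiv α f)) w w := by
  classical
  have hsig := (mem_lorentzian_iff_forall_sigPos_hessian.1 hL).2
  obtain ⟨u, hudef⟩ : ∃ u : σ → ℝ, u = fun k ↦ normCoeff (α + Finsupp.single j 1 + Finsupp.single k 1) f := ⟨_, rfl⟩
  have hPu : (hessian (iterPderiv α f)).mulVec (Pi.single j 1) = u := by rw [hudef, hessian_iterPderiv_mulVec_single]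
  have huw : ∑ a, u a * w a = 0 := by
    rw [← hPu, sum_mulVec_mul_eq_toBilin', toBilin'_hessian_comm (iterPderiv α f) (Pi.single j 1) w, hw]
  have hQww : θ * α i * Matrix.toBilin' (hessian (iterPderiv (α - Finsupp.single i 1 + Finsupp.single j 1) f)) w w ≤
      0 := by
    rcases eq_or_ne (α i) 0 with hαi | hαi
    · rw [hαi, Nat.cast_zero, mul_zero, zero_mul]
    · have hdeg : (α - Finsupp.single i 1 + Finsupp.single j 1).degree = m := by
        rw [degree_sub_single_add_single hαi, hα]
      have hQu : (hessian (iterPderiv (α - Finsupp.single i 1 + Finsupp.single j 1) f)).mulVec (Pi.single i 1) = u := by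
        rw [hudef, hessian_iterPderiv_sub_add_mulVec_single hαi]
      have hQii : 0 < Matrix.toBilin' (hessian (iterPderiv (α - Finsupp.single i 1 + Finsupp.single j 1) f))
          (Pi.single i 1) (Pi.single i 1) := by
        rw [Matrix.toBilin'_single]; exact hessian_iterPderiv_apply_pos hP hdeg i i
      have hQwi : Matrix.toBilin' (hessian (iterPderiv (α - Finsupp.single i 1 + Finsupp.single j 1) f)) w
          (Pi.single i 1) = 0 := by
        rw [← sum_mulVec_mul_eq_toBilin', hQu, huw]
      have hle := self_nonpos_of_orthogonal_of_self_pos _ (isSymm_toBilin'_of_isSymm (isSymm_hessian _))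
        (hsig _ hdeg) hQii hQwi
      exact mul_nonpos_of_nonneg_of_nonpos (mul_nonneg hθ (Nat.cast_nonneg _)) hle
  rw [hessian_iterPderiv_oneAddXPderiv, ← hudef, toBilin'_borderUpdate, huw]
  simp only [mul_zero, add_zero, map_add, map_smul, LinearMap.add_apply, LinearMap.smul_apply, smul_eq_mul]
  linarith

/-- **Brändén–Huh, proof of Lemma 2.12, claim (III), in Hessian form: "A multiple zero of `∂^α g` is necessarily a
multiple zero of `∂^α f`"** — for `f ∈ L^{m+2}_n ∩ P^{m+2}_n`, `g = (1 + θ w_i ∂_j) f` (`θ ≥ 0`), `α ∈ Δ^m_n` and the line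
`x e_j - v`: if `∂^α g` has a double zero (`B_G(v,v)B_G(e_j,e_j) = B_G(v,e_j)²`) then so has `∂^α f`, and the two
critical points `B(e_j,v)/B(e_j,e_j)` coincide. [cite: BrandenHuh2019, §2.3 proof of Lemma 2.12, claim (III) (p. 16)] -/
theorem mul_eq_sq_and_crit_eq_of_oneAddXPderiv {m : ℕ} {f : MvPolynomial σ ℝ} (hL : f ∈ lorentzian σ (m + 2))
    (hP : ∀ β : σ →₀ ℕ, β.degree = m + 2 → 0 < coeff β f) {θ : ℝ} (hθ : 0 ≤ θ) (i j : σ) {α : σ →₀ ℕ}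
    (hα : α.degree = m) {v : σ → ℝ}
    (h0 : Matrix.toBilin' (hessian (iterPderiv α (oneAddXPderiv θ i j f))) v v *
        Matrix.toBilin' (hessian (iterPderiv α (oneAddXPderiv θ i j f))) (Pi.single j 1) (Pi.single j 1) =
      Matrix.toBilin' (hessian (iterPderiv α (oneAddXPderiv θ i j f))) v (Pi.single j 1) ^ 2) :
    Matrix.toBilin' (hessian (iterPderiv α f)) v v *
        Matrix.toBilin' (hessian (iterPderiv α f)) (Pi.single j 1) (Pi.single j 1) =
      Matrix.toBilin' (hessian (iterPderiv α f)) v (Pi.single j 1) ^ 2 ∧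
    Matrix.toBilin' (hessian (iterPderiv α (oneAddXPderiv θ i j f))) (Pi.single j 1) v /
        Matrix.toBilin' (hessian (iterPderiv α (oneAddXPderiv θ i j f))) (Pi.single j 1) (Pi.single j 1) =
      Matrix.toBilin' (hessian (iterPderiv α f)) (Pi.single j 1) v /
        Matrix.toBilin' (hessian (iterPderiv α f)) (Pi.single j 1) (Pi.single j 1) := by
  classical
  have hsig := (mem_lorentzian_iff_forall_sigPos_hessian.1 hL).2
  -- abbreviations `P`, `G`, `e`
  obtain ⟨P, hPdef⟩ : ∃ P, P = hessian (iterPderiv α f) := ⟨_, rfl⟩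
  obtain ⟨G, hGdef⟩ : ∃ G, G = hessian (iterPderiv α (oneAddXPderiv θ i j f)) := ⟨_, rfl⟩
  obtain ⟨e, hedef⟩ : ∃ e : σ → ℝ, e = Pi.single j 1 := ⟨_, rfl⟩
  rw [← hGdef, ← hedef] at h0
  rw [← hPdef, ← hGdef, ← hedef]
  have hPsymm : P.IsSymm := by rw [hPdef]; exact isSymm_hessian _
  have hGsymm : G.IsSymm := by rw [hGdef]; exact isSymm_hessian _
  have hPee : 0 < Matrix.toBilin' P e e := by
    rw [hedef, Matrix.toBilin'_single, hPdef]; exact hessian_iterPderiv_apply_pos hP hα j j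
  have hGee : 0 < Matrix.toBilin' G e e := by
    rw [hedef, Matrix.toBilin'_single, hGdef]
    exact hessian_iterPderiv_apply_pos (fun β hβ ↦ coeff_oneAddXPderiv_pos hθ i j
      (isHomogeneous_of_mem_lorentzian hL) hP β hβ) hα j j
  -- `∂^α f` has a double zero: `≤` by the reverse Cauchy–Schwarz inequality, `<` excluded by claim (I)
  have hle : Matrix.toBilin' P v v * Matrix.toBilin' P e e ≤ Matrix.toBilin' P v e ^ 2 := by
    rw [hPdef]; exact mul_le_sq_of_sigPos_le_one _ (isSymm_toBilin'_of_isSymm (isSymm_hessian _)) (hsig α hα) v _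
      (by rw [← hPdef]; exact hPee.le)
  have hPeq : Matrix.toBilin' P v v * Matrix.toBilin' P e e = Matrix.toBilin' P v e ^ 2 := by
    by_contra hne
    have hlt := mul_lt_sq_hessian_iterPderiv_oneAddXPderiv hL hP hθ i j hα (v := v)
      (by rw [← hPdef, ← hedef]; exact lt_of_le_of_ne hle hne)
    rw [← hGdef, ← hedef] at hlt
    exact hlt.ne h0
  refine ⟨hPeq, ?_⟩
  -- the double zero `c` of `∂^α f`, `w = c e - v`: `B_P(e, w) = 0`, `B_P(w, w) = 0`
  obtain ⟨c, hcdef⟩ : ∃ c : ℝ, c = Matrix.toBilin' P e v / Matrix.toBilin' P e e := ⟨_, rfl⟩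
  have hPew : Matrix.toBilin' P e (c • e - v) = 0 := by rw [hcdef]; exact toBilin'_self_smul_sub_eq_zero P hPee.ne' v
  have hPvv : Matrix.toBilin' P e e * Matrix.toBilin' P v v - Matrix.toBilin' P e v ^ 2 = 0 := by
    rw [symm_apply (isSymm_toBilin'_of_isSymm hPsymm) e v]; linarith
  have hc0 : Matrix.toBilin' P e e * c - Matrix.toBilin' P e v = 0 := by
    rw [hcdef, mul_div_cancel₀ _ hPee.ne', sub_self]
  have hPww : Matrix.toBilin' P (c • e - v) (c • e - v) = 0 := by
    have h := toBilin'_self_mul_smul_sub_self hPsymm c e v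
    rw [hPvv, hc0, add_zero, sq, mul_zero] at h
    exact (mul_eq_zero.1 h).resolve_left hPee.ne'
  -- `∂^α g|_{x=c} ≤ 0`, and `< 0` would give two distinct zeros of `∂^α g`
  have hGww_le : Matrix.toBilin' G (c • e - v) (c • e - v) ≤ 0 := by
    have h := toBilin'_hessian_iterPderiv_oneAddXPderiv_le hL hP hθ i j hα (w := c • e - v)
      (by rw [← hPdef, ← hedef]; exact hPew)
    rw [← hPdef, ← hGdef, hPww] at h
    exact h
  have hGww : Matrix.toBilin' G (c • e - v) (c • e - v) = 0 := by
    by_contra hne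
    have hlt := mul_lt_sq_of_toBilin'_smul_sub_self_neg hGsymm hGee (x := c) (lt_of_le_of_ne hGww_le hne)
    exact hlt.ne h0
  -- hence `c` is the double zero of `∂^α g` too
  have hGvv : Matrix.toBilin' G e e * Matrix.toBilin' G v v - Matrix.toBilin' G e v ^ 2 = 0 := by
    rw [symm_apply (isSymm_toBilin'_of_isSymm hGsymm) e v]; linarith
  have h := toBilin'_self_mul_smul_sub_self hGsymm c e v
  rw [hGww, mul_zero, hGvv, add_zero] at h
  have h2 : Matrix.toBilin' G e e * c - Matrix.toBilin' G e v = 0 := by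
    have := (sq_eq_zero_iff.1 h.symm); linarith
  rw [← hcdef, div_eq_iff hGee.ne']
  linarith

end ClaimIII

/-! ## §4 Claim (II): the `d`-th power produces two distinct zeros whenever `v_i ≠ 0` -/

section ClaimII

/-- **Brändén–Huh, proof of Lemma 2.12, claim (II), in Hessian form: "If `v_i` is nonzero, then
`∂^α (1 + θ w_i ∂_n)^d f` has two distinct real zeros"** on the line `x e_j - v` — for `f ∈ L^d_n ∩ P^d_n` (`d = m + 2`),
`θ > 0`, `i ≠ j`, `α ∈ Δ^m_n`: the strict inequality `B(v,v)B(e_j,e_j) < B(v,e_j)²` for the Hessian of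
`∂^α (1 + θ w_i ∂_j)^d f`. (Otherwise, by (III) descending through the powers, the common critical vector `w` is a zero
of every `∂^α (1 + θ w_i ∂_j)^k f`, `k ≤ d`, hence of every `∂^α w_i^k ∂_j^k f`, and `∂^α w_i^{α_i+2} ∂_j^{α_i+2} f (w)`
is a positive multiple of `v_i²`.) [cite: BrandenHuh2019, §2.3 proof of Lemma 2.12, claim (II) (p. 16)] -/
theorem mul_lt_sq_hessian_iterPderiv_iterate_oneAddXPderiv {m : ℕ} {f : MvPolynomial σ ℝ}
    (hL : f ∈ lorentzian σ (m + 2)) (hP : ∀ β : σ →₀ ℕ, β.degree = m + 2 → 0 < coeff β f) {θ : ℝ} (hθ : 0 < θ)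
    {i j : σ} (hij : i ≠ j) {α : σ →₀ ℕ} (hα : α.degree = m) {v : σ → ℝ} (hvi : v i ≠ 0) :
    Matrix.toBilin' (hessian (iterPderiv α ((oneAddXPderiv θ i j)^[m + 2] f))) v v *
        Matrix.toBilin' (hessian (iterPderiv α ((oneAddXPderiv θ i j)^[m + 2] f))) (Pi.single j 1)
          (Pi.single j 1) <
      Matrix.toBilin' (hessian (iterPderiv α ((oneAddXPderiv θ i j)^[m + 2] f))) v (Pi.single j 1) ^ 2 := by
  classical
  have hhom := isHomogeneous_of_mem_lorentzian hL
  have hLk := iterate_oneAddXPderiv_mem_lorentzian hL hθ.le i j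
  have hPk := coeff_iterate_oneAddXPderiv_pos hhom hP hθ.le i j
  have hsigk : ∀ k, sigPos (Matrix.toBilin' (hessian (iterPderiv α ((oneAddXPderiv θ i j)^[k] f)))).toQuadraticMap ≤
      1 := fun k ↦ (mem_lorentzian_iff_forall_sigPos_hessian.1 (hLk k)).2 α hα
  have heek : ∀ k, 0 < Matrix.toBilin' (hessian (iterPderiv α ((oneAddXPderiv θ i j)^[k] f))) (Pi.single j 1)
      (Pi.single j 1) := fun k ↦ by
    rw [Matrix.toBilin'_single]; exact hessian_iterPderiv_apply_pos (hPk k) hα j j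
  by_contra hlt
  have h0 : Matrix.toBilin' (hessian (iterPderiv α ((oneAddXPderiv θ i j)^[m + 2] f))) v v *
        Matrix.toBilin' (hessian (iterPderiv α ((oneAddXPderiv θ i j)^[m + 2] f))) (Pi.single j 1)
          (Pi.single j 1) =
      Matrix.toBilin' (hessian (iterPderiv α ((oneAddXPderiv θ i j)^[m + 2] f))) v (Pi.single j 1) ^ 2 :=
    le_antisymm (mul_le_sq_of_sigPos_le_one _ (isSymm_toBilin'_of_isSymm (isSymm_hessian _)) (hsigk _) v _
      (heek _).le) (not_lt.1 hlt)
  -- the common critical point `c`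
  obtain ⟨c, hcdef⟩ : ∃ c : ℝ,
      c = Matrix.toBilin' (hessian (iterPderiv α ((oneAddXPderiv θ i j)^[m + 2] f))) (Pi.single j 1) v /
        Matrix.toBilin' (hessian (iterPderiv α ((oneAddXPderiv θ i j)^[m + 2] f))) (Pi.single j 1)
          (Pi.single j 1) := ⟨_, rfl⟩
  -- descending induction (claim (III)): every power `k ≤ d` has a double zero at `c`
  have hdesc : ∀ s ≤ m + 2,
      Matrix.toBilin' (hessian (iterPderiv α ((oneAddXPderiv θ i j)^[m + 2 - s] f))) v v *
          Matrix.toBilin' (hessian (iterPderiv α ((oneAddXPderiv θ i j)^[m + 2 - s] f))) (Pi.single j 1)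
            (Pi.single j 1) =
        Matrix.toBilin' (hessian (iterPderiv α ((oneAddXPderiv θ i j)^[m + 2 - s] f))) v (Pi.single j 1) ^ 2 ∧
      Matrix.toBilin' (hessian (iterPderiv α ((oneAddXPderiv θ i j)^[m + 2 - s] f))) (Pi.single j 1) v /
          Matrix.toBilin' (hessian (iterPderiv α ((oneAddXPderiv θ i j)^[m + 2 - s] f))) (Pi.single j 1)
            (Pi.single j 1) = c := by
    intro s
    induction s with
    | zero => intro; exact ⟨h0, hcdef.symm⟩
    | succ s ih =>
      intro hs
      obtain ⟨h0', hc'⟩ := ih (by omega)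
      have hk : m + 2 - s = (m + 2 - (s + 1)) + 1 := by omega
      rw [hk, Function.iterate_succ_apply'] at h0' hc'
      obtain ⟨hP0, hcrit⟩ := mul_eq_sq_and_crit_eq_of_oneAddXPderiv (hLk _) (hPk _) hθ.le i j hα h0'
      exact ⟨hP0, by rw [← hcrit, hc']⟩
  -- hence `∂^α (1 + θ w_i ∂_j)^k f` vanishes at `w = c e_j - v` for all `k ≤ d`
  have hzero : ∀ k ≤ m + 2, eval (c • Pi.single j 1 - v) (iterPderiv α ((oneAddXPderiv θ i j)^[k] f)) = 0 := by
    intro k hk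
    obtain ⟨h0k, hck⟩ := hdesc (m + 2 - k) (by omega)
    rw [show m + 2 - (m + 2 - k) = k by omega] at h0k hck
    have hsymm := isSymm_toBilin'_of_isSymm (isSymm_hessian (iterPderiv α ((oneAddXPderiv θ i j)^[k] f)))
    have h := toBilin'_self_mul_smul_sub_self (isSymm_hessian (iterPderiv α ((oneAddXPderiv θ i j)^[k] f))) c
      (Pi.single j 1) v
    have hb : Matrix.toBilin' (hessian (iterPderiv α ((oneAddXPderiv θ i j)^[k] f))) (Pi.single j 1) v =
        Matrix.toBilin' (hessian (iterPderiv α ((oneAddXPderiv θ i j)^[k] f))) (Pi.single j 1) (Pi.single j 1) *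
          c := by
      rw [← hck, mul_div_cancel₀ _ (heek k).ne']
    have hdisc : Matrix.toBilin' (hessian (iterPderiv α ((oneAddXPderiv θ i j)^[k] f))) (Pi.single j 1)
          (Pi.single j 1) * Matrix.toBilin' (hessian (iterPderiv α ((oneAddXPderiv θ i j)^[k] f))) v v -
        Matrix.toBilin' (hessian (iterPderiv α ((oneAddXPderiv θ i j)^[k] f))) (Pi.single j 1) v ^ 2 = 0 := by
      rw [symm_apply hsymm (Pi.single j 1) v]
      linarith [h0k]
    rw [hdisc, add_zero, hb, sub_self, sq, mul_zero] at h
    have hww := (mul_eq_zero.1 h).resolve_left (heek k).ne'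
    have h2 := two_mul_eval_eq_toBilin'_hessian (IsHomogeneous.iterPderiv α (by
      rw [hα, add_comm 2 m]; exact isHomogeneous_iterate_oneAddXPderiv hhom θ i j k)) (c • Pi.single j 1 - v)
    rw [hww] at h2
    linarith
  -- "Expanding the k-th power": all `∂^α w_i^l ∂_j^l f` vanish at `w`, `l ≤ d`
  have hsum : ∀ k ≤ m + 2, ∑ l ∈ Finset.range (k + 1), θ ^ l * (k.choose l : ℝ) *
      eval (c • Pi.single j 1 - v) (iterPderiv α (X i ^ l * (pderiv j)^[l] f)) = 0 := by
    intro k hk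
    have h := hzero k hk
    rw [iterate_oneAddXPderiv_eq_sum hij, iterPderiv_sum, map_sum] at h
    rw [← h]
    refine Finset.sum_congr rfl fun l _ ↦ ?_
    rw [iterPderiv_smul, smul_eval]
  have hEl := eq_zero_of_forall_sum_choose_mul_eq_zero hθ.ne' hsum
  -- but `∂^α w_i^{α_i+2} ∂_j^{α_i+2} f (w)` is a positive multiple of `v_i²`
  have hαi : α i ≤ m := hα ▸ Finsupp.le_degree i α
  have hE := hEl (α i + 2) (by omega)
  have hq : (iterPderiv α (X i ^ (α i + 2) * (pderiv j)^[α i + 2] f)).IsHomogeneous 2 := by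
    refine IsHomogeneous.iterPderiv α ?_
    rw [iterate_pderiv_eq_iterPderiv]
    have h1 : (X i ^ (α i + 2) : MvPolynomial σ ℝ).IsHomogeneous (α i + 2) := isHomogeneous_X_pow i _
    have h2 : (iterPderiv (Finsupp.single j (α i + 2)) f).IsHomogeneous (m - α i) :=
      IsHomogeneous.iterPderiv _ (by rw [degree_single, show m - α i + (α i + 2) = m + 2 by omega]; exact hhom)
    have h3 := h1.mul h2
    rw [show α i + 2 + (m - α i) = 2 + m by omega] at h3
    rwa [hα]
  have h2 := two_mul_eval_iterPderiv_X_pow_mul α i hq (c • Pi.single j 1 - v)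
  rw [hE, mul_zero] at h2
  have hwi : (c • Pi.single j 1 - v : σ → ℝ) i = -v i := by
    rw [Pi.sub_apply, Pi.smul_apply, Pi.single_eq_of_ne hij, smul_zero, zero_sub]
  rw [hwi, neg_sq] at h2
  have hK : 0 < factorialProd (α + Finsupp.single i 1 + Finsupp.single i 1) *
      coeff (α.erase i) ((pderiv j)^[α i + 2] f) :=
    mul_pos (factorialProd_pos _) (coeff_erase_iterate_pderiv_pos hP hα i j)
  have hv2 : 0 < v i ^ 2 := by positivity
  nlinarith

end ClaimII

/-! ## §5 Lemma 2.12 -/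

section Lemma212

/-- **Brändén–Huh's operator `T_n(θ, -) = ∏_{i ≠ n} (1 + θ w_i ∂_n)^d`** (with the distinguished variable `n ↦ j` and the
commuting blocks `(1 + θ w_i ∂_j)^d` composed in the order of `Finset.toList`). [cite: BrandenHuh2019, §2.3 (p. 15,
"We define a linear operator `T_n(θ, -)` by `T_n(θ, f) = (∏_{i=1}^{n-1} (1 + θ w_i ∂_n)^d) f`")] -/
def nuijOperator (θ : ℝ) (j : σ) (d : ℕ) (f : MvPolynomial σ ℝ) : MvPolynomial σ ℝ :=
  (Finset.univ.erase j).toList.foldr (fun i g ↦ (oneAddXPderiv θ i j)^[d] g) f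

/-- `T_n(θ, f)` unfolded. [cite: BrandenHuh2019, §2.3 (p. 15)] -/
theorem nuijOperator_def (θ : ℝ) (j : σ) (d : ℕ) (f : MvPolynomial σ ℝ) :
    nuijOperator θ j d f = (Finset.univ.erase j).toList.foldr (fun i g ↦ (oneAddXPderiv θ i j)^[d] g) f := rfl

/-- A composite of blocks `(1 + θ w_i ∂_j)^d`, `θ ≥ 0`, preserves `L^d_n` (Prop. 2.7). [cite: BrandenHuh2019, §2.3
(p. 15, "By Proposition 2.7, if `f ∈ L^d_n`, then `T_n(θ, f) ∈ L^d_n`")] -/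
theorem foldr_iterate_oneAddXPderiv_mem_lorentzian {d e : ℕ} {θ : ℝ} (hθ : 0 ≤ θ) (j : σ) :
    ∀ (l : List σ) {f : MvPolynomial σ ℝ}, f ∈ lorentzian σ d →
      l.foldr (fun i g ↦ (oneAddXPderiv θ i j)^[e] g) f ∈ lorentzian σ d
  | [], _, hf => by simpa using hf
  | i :: l, f, hf => by
    rw [List.foldr_cons]
    exact iterate_oneAddXPderiv_mem_lorentzian (foldr_iterate_oneAddXPderiv_mem_lorentzian hθ j l hf) hθ i j e

omit [Fintype σ] [DecidableEq σ] in
/-- A composite of blocks `(1 + θ w_i ∂_j)^d` preserves `H^d_n`. [cite: BrandenHuh2019, §2.3 (p. 15)] -/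
theorem isHomogeneous_foldr_iterate_oneAddXPderiv {d e : ℕ} (θ : ℝ) (j : σ) :
    ∀ (l : List σ) {f : MvPolynomial σ ℝ}, f.IsHomogeneous d →
      (l.foldr (fun i g ↦ (oneAddXPderiv θ i j)^[e] g) f).IsHomogeneous d
  | [], _, hf => by simpa using hf
  | i :: l, f, hf => by
    rw [List.foldr_cons]
    exact isHomogeneous_iterate_oneAddXPderiv (isHomogeneous_foldr_iterate_oneAddXPderiv θ j l hf) θ i j e

omit [DecidableEq σ] in
/-- A composite of blocks `(1 + θ w_i ∂_j)^d`, `θ ≥ 0`, preserves `P^d_n`. [cite: BrandenHuh2019, §2.3 (p. 15, "if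
`f ∈ P^d_n`, then `T_n(θ, f) ∈ P^d_n`")] -/
theorem coeff_foldr_iterate_oneAddXPderiv_pos [DecidableEq σ] {d e : ℕ} {θ : ℝ} (hθ : 0 ≤ θ) (j : σ) :
    ∀ (l : List σ) {f : MvPolynomial σ ℝ}, f.IsHomogeneous d → (∀ β : σ →₀ ℕ, β.degree = d → 0 < coeff β f) →
      ∀ β : σ →₀ ℕ, β.degree = d → 0 < coeff β (l.foldr (fun i g ↦ (oneAddXPderiv θ i j)^[e] g) f)
  | [], _, _, hpos => by simpa using hpos
  | i :: l, f, hf, hpos => by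
    rw [List.foldr_cons]
    exact coeff_iterate_oneAddXPderiv_pos (isHomogeneous_foldr_iterate_oneAddXPderiv θ j l hf)
      (coeff_foldr_iterate_oneAddXPderiv_pos hθ j l hf hpos) hθ i j e

/-- Claim (I) through a block: two distinct zeros on the line persist under `(1 + θ w_{i'} ∂_j)^e` (`f ∈ L ∩ P`).
[cite: BrandenHuh2019, §2.3 proof of Lemma 2.12 (claim (I), "Using Proposition 2.7")] -/
theorem mul_lt_sq_hessian_iterPderiv_iterate_oneAddXPderiv_of_mul_lt_sq {m : ℕ} {θ : ℝ} (hθ : 0 ≤ θ) (i' j : σ)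
    {α : σ →₀ ℕ} (hα : α.degree = m) {v : σ → ℝ} :
    ∀ (e : ℕ) {f : MvPolynomial σ ℝ}, f ∈ lorentzian σ (m + 2) → (∀ β : σ →₀ ℕ, β.degree = m + 2 → 0 < coeff β f) →
      Matrix.toBilin' (hessian (iterPderiv α f)) v v *
          Matrix.toBilin' (hessian (iterPderiv α f)) (Pi.single j 1) (Pi.single j 1) <
        Matrix.toBilin' (hessian (iterPderiv α f)) v (Pi.single j 1) ^ 2 →
      Matrix.toBilin' (hessian (iterPderiv α ((oneAddXPderiv θ i' j)^[e] f))) v v *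
          Matrix.toBilin' (hessian (iterPderiv α ((oneAddXPderiv θ i' j)^[e] f))) (Pi.single j 1) (Pi.single j 1) <
        Matrix.toBilin' (hessian (iterPderiv α ((oneAddXPderiv θ i' j)^[e] f))) v (Pi.single j 1) ^ 2
  | 0, _, _, _, hv => by simpa using hv
  | e + 1, f, hL, hP, hv => by
    rw [Function.iterate_succ_apply']
    exact mul_lt_sq_hessian_iterPderiv_oneAddXPderiv (iterate_oneAddXPderiv_mem_lorentzian hL hθ i' j e)
      (coeff_iterate_oneAddXPderiv_pos (isHomogeneous_of_mem_lorentzian hL) hP hθ i' j e) hθ i' j hα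
      (mul_lt_sq_hessian_iterPderiv_iterate_oneAddXPderiv_of_mul_lt_sq hθ i' j hα e hL hP hv)

/-- The per-line induction over the blocks: if the block of some `i ≠ j` with `v_i ≠ 0` occurs in the composite, then
`∂^α` of the composite has two distinct real zeros on `x e_j - v` (claim (II) at that block, claim (I) afterwards).
[cite: BrandenHuh2019, §2.3 proof of Lemma 2.12 ("Using Proposition 2.7, we can deduce the preceding statement from
the following claims")] -/
theorem mul_lt_sq_hessian_iterPderiv_foldr {m : ℕ} {θ : ℝ} (hθ : 0 < θ) (j : σ) {α : σ →₀ ℕ} (hα : α.degree = m)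
    {v : σ → ℝ} {i : σ} (hij : i ≠ j) (hvi : v i ≠ 0) :
    ∀ (l : List σ), i ∈ l → ∀ {f : MvPolynomial σ ℝ}, f ∈ lorentzian σ (m + 2) →
      (∀ β : σ →₀ ℕ, β.degree = m + 2 → 0 < coeff β f) →
      Matrix.toBilin' (hessian (iterPderiv α (l.foldr (fun i g ↦ (oneAddXPderiv θ i j)^[m + 2] g) f))) v v *
          Matrix.toBilin' (hessian (iterPderiv α (l.foldr (fun i g ↦ (oneAddXPderiv θ i j)^[m + 2] g) f)))
            (Pi.single j 1) (Pi.single j 1) <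
        Matrix.toBilin' (hessian (iterPderiv α (l.foldr (fun i g ↦ (oneAddXPderiv θ i j)^[m + 2] g) f))) v
          (Pi.single j 1) ^ 2
  | [], hi, _, _, _ => absurd hi (List.not_mem_nil)
  | i' :: l, hi, f, hL, hP => by
    rw [List.foldr_cons]
    have hL' := foldr_iterate_oneAddXPderiv_mem_lorentzian (e := m + 2) hθ.le j l hL
    have hP' := coeff_foldr_iterate_oneAddXPderiv_pos (e := m + 2) hθ.le j l (isHomogeneous_of_mem_lorentzian hL) hP
    rcases List.mem_cons.1 hi with rfl | hi'
    · exact mul_lt_sq_hessian_iterPderiv_iterate_oneAddXPderiv hL' hP' hθ hij hα hvi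
    · exact mul_lt_sq_hessian_iterPderiv_iterate_oneAddXPderiv_of_mul_lt_sq hθ.le i' j hα (m + 2) hL' hP'
        (mul_lt_sq_hessian_iterPderiv_foldr hθ j hα hij hvi l hi' hL hP)

omit [Fintype σ] in
/-- A vector not parallel to `e_j` has a nonzero coordinate off `j`. [cite: BrandenHuh2019, §2.3 proof of Lemma 2.12
("let `v` be any vector in `ℝ^n` not parallel to `e_n`")] -/
theorem exists_ne_apply_ne_zero_of_forall_ne_smul {j : σ} {v : σ → ℝ} (hv : ∀ t : ℝ, v ≠ t • Pi.single j 1) :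
    ∃ i, i ≠ j ∧ v i ≠ 0 := by
  by_contra h
  push Not at h
  refine hv (v j) (funext fun k ↦ ?_)
  by_cases hk : k = j
  · rw [hk, Pi.smul_apply, Pi.single_eq_same, smul_eq_mul, mul_one]
  · rw [h k hk, Pi.smul_apply, Pi.single_eq_of_ne hk, smul_zero]

/-- **Brändén–Huh, Lemma 2.12: "If `f ∈ L^d_n ∩ P^d_n`, then `T_n(θ, f) ∈ L̊^d_n` for every positive real number `θ`."**
(For the tree's Definition-2.6 `lorentzian` and Definition-2.1 `strictlyLorentzian`; `T_n` = `nuijOperator θ j d` with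
distinguished variable `j`.) Proof as printed: for `d ≥ 2`, by the second description of `L̊^d_n` and Lemma 2.5
(5) ⟹ (1) with `u = e_j`, it suffices that each `∂^α T(f)` has two distinct real zeros on every line `x e_j - v`,
`v ∦ e_j`; pick `i ≠ j` with `v_i ≠ 0` and run claims (II) (at the block of `i`) and (I) (through the later blocks).
[cite: BrandenHuh2019, §2.3 Lemma 2.12 (p. 15; proof pp. 15–16)] -/
theorem nuijOperator_mem_strictlyLorentzian :
    ∀ {d : ℕ} {f : MvPolynomial σ ℝ}, f ∈ lorentzian σ d → (∀ β : σ →₀ ℕ, β.degree = d → 0 < coeff β f) →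
      ∀ {θ : ℝ}, 0 < θ → ∀ j : σ, nuijOperator θ j d f ∈ strictlyLorentzian σ d
  | 0, _, hL, hP, θ, hθ, j =>
    mem_strictlyLorentzian_zero.2
      ⟨isHomogeneous_foldr_iterate_oneAddXPderiv θ j _ (isHomogeneous_of_mem_lorentzian hL),
        coeff_foldr_iterate_oneAddXPderiv_pos hθ.le j _ (isHomogeneous_of_mem_lorentzian hL) hP⟩
  | 1, _, hL, hP, θ, hθ, j =>
    mem_strictlyLorentzian_one.2
      ⟨isHomogeneous_foldr_iterate_oneAddXPderiv θ j _ (isHomogeneous_of_mem_lorentzian hL),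
        coeff_foldr_iterate_oneAddXPderiv_pos hθ.le j _ (isHomogeneous_of_mem_lorentzian hL) hP⟩
  | m + 2, f, hL, hP, θ, hθ, j => by
    classical
    have hhom' := isHomogeneous_foldr_iterate_oneAddXPderiv (e := m + 2) θ j (Finset.univ.erase j).toList
      (isHomogeneous_of_mem_lorentzian hL)
    have hpos' := coeff_foldr_iterate_oneAddXPderiv_pos (e := m + 2) hθ.le j (Finset.univ.erase j).toList
      (isHomogeneous_of_mem_lorentzian hL) hP
    rw [nuijOperator]
    refine mem_strictlyLorentzian_iff_forall_iterPderiv.2 ⟨⟨hhom', hpos'⟩, fun α hα ↦ ?_⟩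
    have hq : (iterPderiv α ((Finset.univ.erase j).toList.foldr (fun i g ↦ (oneAddXPderiv θ i j)^[m + 2] g) f)).IsHomogeneous 2 :=
      IsHomogeneous.iterPderiv α (by rw [hα, add_comm 2 m]; exact hhom')
    have hqpos : ∀ β : σ →₀ ℕ, β.degree = 2 → 0 < coeff β
        (iterPderiv α ((Finset.univ.erase j).toList.foldr (fun i g ↦ (oneAddXPderiv θ i j)^[m + 2] g) f)) :=
      fun β hβ ↦ by
        rw [← normCoeff_pos_iff, normCoeff_iterPderiv, normCoeff_pos_iff]
        exact hpos' _ (by rw [map_add, hα, hβ])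
    have hee : 0 < Matrix.toBilin'
        (hessian (iterPderiv α ((Finset.univ.erase j).toList.foldr (fun i g ↦ (oneAddXPderiv θ i j)^[m + 2] g) f)))
        (Pi.single j 1) (Pi.single j 1) := by
      rw [Matrix.toBilin'_single]; exact hessian_iterPderiv_apply_pos hpos' hα j j
    refine mem_strictlyLorentzian_two_of_mul_lt_sq hq hqpos hee fun v hv ↦ ?_
    obtain ⟨i, hij, hvi⟩ := exists_ne_apply_ne_zero_of_forall_ne_smul hv
    exact mul_lt_sq_hessian_iterPderiv_foldr hθ j hα hij hvi _
      (Finset.mem_toList.2 (Finset.mem_erase.2 ⟨hij, Finset.mem_univ i⟩)) hL hP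

/-- `T_n(θ, -)` preserves `L^d_n` for `θ ≥ 0`. [cite: BrandenHuh2019, §2.3 (p. 15, "By Proposition 2.7, if `f ∈ L^d_n`,
then `T_n(θ, f) ∈ L^d_n`")] -/
theorem nuijOperator_mem_lorentzian {d : ℕ} {f : MvPolynomial σ ℝ} (hf : f ∈ lorentzian σ d) {θ : ℝ} (hθ : 0 ≤ θ)
    (j : σ) : nuijOperator θ j d f ∈ lorentzian σ d :=
  foldr_iterate_oneAddXPderiv_mem_lorentzian hθ j _ hf

/-- `T_n(θ, -)` preserves `P^d_n` for `θ ≥ 0`. [cite: BrandenHuh2019, §2.3 (p. 15, "In addition, if `f ∈ P^d_n`, then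
`T_n(θ, f) ∈ P^d_n`")] -/
theorem coeff_nuijOperator_pos {d : ℕ} {f : MvPolynomial σ ℝ} (hf : f.IsHomogeneous d)
    (hpos : ∀ β : σ →₀ ℕ, β.degree = d → 0 < coeff β f) {θ : ℝ} (hθ : 0 ≤ θ) (j : σ) (β : σ →₀ ℕ)
    (hβ : β.degree = d) : 0 < coeff β (nuijOperator θ j d f) :=
  coeff_foldr_iterate_oneAddXPderiv_pos hθ j _ hf hpos β hβ

omit [Fintype σ] [DecidableEq σ] in
/-- `T_n(0, f) = f`. [cite: BrandenHuh2019, §2.3 proof of Thm. 2.13 (the homotopy at `θ = 0`)] -/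
theorem nuijOperator_zero [Fintype σ] [DecidableEq σ] (j : σ) (d : ℕ) (f : MvPolynomial σ ℝ) :
    nuijOperator 0 j d f = f := by
  rw [nuijOperator]
  have hblock : ∀ (i : σ) (g : MvPolynomial σ ℝ), (oneAddXPderiv 0 i j)^[d] g = g := fun i g ↦ by
    have h1 : oneAddXPderiv 0 i j = id := funext fun g ↦ oneAddXPderiv_zero i j g
    rw [h1, Function.iterate_id, id_eq]
  induction (Finset.univ.erase j).toList with
  | nil => rfl
  | cons i l ih => rw [List.foldr_cons, hblock, ih]

end Lemma212

end Literature.Combinatorics.LorentzianPolynomials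

end
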